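import Summits.ResolutionOfSingularities.ResolutionOfSingularities.Theorems.WeightedInvariantDescentPerfectToAllDescendResolutionProps
import Literature.AlgebraicGeometry.Resolution.QuasiProjectiveResolution
import Literature.AlgebraicGeometry.Resolution.ResolutionOfComponents
import Mathlib.AlgebraicGeometry.FunctionField
import Mathlib.AlgebraicGeometry.Morphisms.UniversallyInjective
import Mathlib.AlgebraicGeometry.Morphisms.Finite
import Mathlib.FieldTheory.KummerPolynomial
import Mathlib.FieldTheory.PurelyInseparable.PerfectClosure
import Mathlib.RingTheory.TensorProduct.Nontrivial
import HarnessLib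

/-!
# `WeightedInvariant.DescentPerfectToAll`, line `root-of-a-constant`: reduction of the one-root
step to geometrically integral `X`

Route `ResolutionOfSingularities/WeightedInvariant`, crux `DescentPerfectToAll`
(stmt-ResolutionOfSingularities-0549), stub `stub_oneRootReduceToGeomIntegral` (R2) of the lead's
skeleton, PROVED here (statement verbatim from the ledger registration).

**Statement.** Fix a prime `p`, fields `k ⊆ K = k(α)` of characteristic `p` with
`α ^ p = a ∈ k ∖ k^p`, and an integral separated `k`-scheme of finite type `f : X → Spec k`; put
`X_K = X ×ₖ Spec K`. The CORE says: if `X_K` is integral and admits a resolution, so does `X`.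
The ONE-ROOT STEP says: if `ι : Z ↪ X_K` is a surjective closed immersion from a reduced scheme
(`Z = (X_K)_red`) admitting a resolution, then `X` admits one. We prove CORE ⇒ ONE-ROOT STEP.

**Proof** (`hasResolution_of_oneRoot_core`). `X_K → X` is finite, surjective and radicial (`K/k`
is finite purely inseparable), so `ρ : Z ↪ X_K → X` is a finite homeomorphism and `Z` is
integral. Let `a_X` be the image of `a` in the function field `k(X)`.
* If `a_X = γ^p` with `γ ∈ k(X)`, then `γ` is the germ of a section `β` over a non-empty affine
  open `U = Spec A` with `β^p = a` (`Γ(X, U) ↪ k(X)`, `X` being integral); `T ↦ β` gives a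
  `k`-map `K ≅ k[T]/(T^p - a) → A` (`T^p - a` is irreducible, Mathlib
  `X_pow_sub_C_irreducible_of_prime`), i.e. a section `U → U ×ₖ Spec K` of the projection,
  which factors through `Z` since `U` is reduced (`exists_section_of_pow_eq`). An injective
  affine morphism from a reduced scheme with a section over `U` is an isomorphism over `U`
  (`isIso_morphismRestrict_of_section`), so `ρ` is proper birational and a resolution of `Z`
  gives one of `X` (`Scheme.HasResolution.of_isBirational`).
* Otherwise `T^p - a` is irreducible over `F = k(X)`, `F ⊗ₖ K ≅ F[T]/(T^p - a)` is a field and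
  `A ⊗ₖ K ⊆ F ⊗ₖ K` (`K` is flat over `k`) is a domain for every non-empty affine open
  `Spec A ⊆ X` (`isDomain_tensorProduct_of_forall_pow_ne`); as `(Spec A) ×ₖ Spec K =
  Spec (A ⊗ₖ K)` (Mathlib `pullbackSpecIso`), `X_K` is reduced
  (`isReduced_pullback_of_forall_pow_ne`), the surjective closed immersion `ι` is an
  isomorphism, `X_K ≅ Z` is integral with a resolution, and the core applies.
-/

set_option linter.dupNamespace false -- mandated namespace of this single-conjunct summit

noncomputable section

open CategoryTheory CategoryTheory.Limits AlgebraicGeometry TopologicalSpace Topology Polynomial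
open Literature.AlgebraicGeometry.Resolution Literature.AlgebraicGeometry.Morphisms
open scoped TensorProduct

namespace Summit.ResolutionOfSingularities.ResolutionOfSingularities.Theorems

universe u

/-! ## Algebra of the simple radicial extension `K = k(α)`, `α ^ p = a ∉ k ^ p` -/

section Algebra

variable {k K : Type*} [Field k] [Field K] [Algebra k K] {p : ℕ} [hp : Fact p.Prime]

/-- `α` with `α ^ p ∈ k` is integral over `k`. [folklore] -/
theorem isIntegral_of_pow_eq (a : k) (α : K) (hα : α ^ p = algebraMap k K a) : IsIntegral k α :=
  ⟨X ^ p - C a, monic_X_pow_sub_C a hp.out.ne_zero, by simp [hα]⟩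

/-- If `K = k(α)` as a field and `α` is algebraic, then `K = k[α]` as an algebra. [folklore] -/
theorem algebraAdjoin_eq_top_of_pow_eq (a : k) (α : K) (hα : α ^ p = algebraMap k K a)
    (htop : IntermediateField.adjoin k {α} = ⊤) : Algebra.adjoin k {α} = ⊤ := by
  rw [← IntermediateField.adjoin_simple_toSubalgebra_of_isAlgebraic
    (isIntegral_of_pow_eq a α hα).isAlgebraic, htop, IntermediateField.top_toSubalgebra]

/-- **Universal property of `K = k(a^{1/p})`, `a ∉ k^p`.** Every `k`-algebra `B` containing a
`p`-th root `β` of `a` receives a `k`-algebra map from `K` (indeed `K ≅ k[T]/(T^p - a)` since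
`T^p - a` is irreducible over `k`). [folklore] -/
theorem nonempty_algHom_of_pow_eq (a : k) (α : K) (ha : ∀ b : k, b ^ p ≠ a)
    (hα : α ^ p = algebraMap k K a) (htop : IntermediateField.adjoin k {α} = ⊤)
    {B : Type*} [CommRing B] [Algebra k B] (β : B) (hβ : β ^ p = algebraMap k B a) :
    Nonempty (K →ₐ[k] B) := by
  set P : k[X] := X ^ p - C a with hP
  haveI : Fact (Irreducible P) := ⟨X_pow_sub_C_irreducible_of_prime hp.out ha⟩
  let e₀ : AdjoinRoot P →ₐ[k] K := AdjoinRoot.liftAlgHom P (Algebra.ofId k K) α (by simp [hP, hα])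
  have he₀ : Function.Bijective e₀ := by
    refine ⟨e₀.toRingHom.injective, ?_⟩
    rw [← AlgHom.range_eq_top, eq_top_iff, ← algebraAdjoin_eq_top_of_pow_eq a α hα htop,
      Algebra.adjoin_le_iff, Set.singleton_subset_iff]
    exact ⟨AdjoinRoot.root P, AdjoinRoot.liftAlgHom_root P _ α _⟩
  exact ⟨(AdjoinRoot.liftAlgHom P (Algebra.ofId k B) β (by simp [hP, hβ])).comp
    (AlgEquiv.ofBijective e₀ he₀).symm.toAlgHom⟩

/-- **`A ⊗ₖ k(a^{1/p})` is a domain for `k ⊆ A ⊆ F`, `F` a field with `a ∉ F^p`.** The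
`F`-algebra map `F[T]/(T^p - a) → F ⊗ₖ K`, `T ↦ 1 ⊗ α`, is injective (its source is a field,
`T^p - a` being irreducible over `F`) and surjective (`K = k[α]`), so `F ⊗ₖ K` is a field, and
`A ⊗ₖ K ⊆ F ⊗ₖ K` since `K` is flat over `k`. [folklore] -/
theorem isDomain_tensorProduct_of_forall_pow_ne {A F : Type*} [CommRing A] [Field F] [Algebra k A]
    [Algebra k F] [Algebra A F] [IsScalarTower k A F] (hAF : Function.Injective (algebraMap A F))
    (a : k) (α : K) (hα : α ^ p = algebraMap k K a) (htop : IntermediateField.adjoin k {α} = ⊤)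
    (hF : ∀ γ : F, γ ^ p ≠ algebraMap k F a) : IsDomain (A ⊗[k] K) := by
  set PF : F[X] := X ^ p - C (algebraMap k F a) with hPF
  haveI : Fact (Irreducible PF) := ⟨X_pow_sub_C_irreducible_of_prime hp.out hF⟩
  have hroot : eval₂ (↑(Algebra.ofId F (F ⊗[k] K))) ((1 : F) ⊗ₜ[k] α) PF = 0 := by
    rw [hPF, eval₂_sub, eval₂_X_pow, eval₂_C, sub_eq_zero, Algebra.TensorProduct.tmul_pow,
      one_pow, hα]
    change (1 : F) ⊗ₜ[k] algebraMap k K a = algebraMap F (F ⊗[k] K) (algebraMap k F a)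
    rw [Algebra.TensorProduct.algebraMap_apply, Algebra.algebraMap_self_apply,
      Algebra.algebraMap_eq_smul_one, Algebra.algebraMap_eq_smul_one a, TensorProduct.tmul_smul,
      TensorProduct.smul_tmul']
  let χ : AdjoinRoot PF →ₐ[F] F ⊗[k] K :=
    AdjoinRoot.liftAlgHom PF (Algebra.ofId F (F ⊗[k] K)) ((1 : F) ⊗ₜ[k] α) hroot
  haveI : Nontrivial (F ⊗[k] K) :=
    Algebra.TensorProduct.nontrivial_of_algebraMap_injective_of_isDomain k F K
      (algebraMap k F).injective (algebraMap k K).injective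
  have h1 : ∀ b : K, (1 : F) ⊗ₜ[k] b ∈ χ.range := by
    have hle : Algebra.adjoin k {α} ≤
        (χ.range.restrictScalars k).comap Algebra.TensorProduct.includeRight := by
      rw [Algebra.adjoin_le_iff, Set.singleton_subset_iff, SetLike.mem_coe, Subalgebra.mem_comap,
        Subalgebra.mem_restrictScalars, Algebra.TensorProduct.includeRight_apply]
      exact ⟨AdjoinRoot.root PF, AdjoinRoot.liftAlgHom_root PF _ _ hroot⟩
    intro b
    have hb : b ∈ Algebra.adjoin k {α} := by
      rw [algebraAdjoin_eq_top_of_pow_eq a α hα htop]; trivial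
    exact hle hb
  have hsurj : Function.Surjective χ := by
    rw [← AlgHom.range_eq_top, eq_top_iff]
    rintro x -
    induction x using TensorProduct.induction_on with
    | zero => exact zero_mem _
    | add x y hx hy => exact add_mem hx hy
    | tmul f b =>
      rw [show f ⊗ₜ[k] b = f • ((1 : F) ⊗ₜ[k] b) by
        rw [TensorProduct.smul_tmul', smul_eq_mul, mul_one]]
      exact Subalgebra.smul_mem _ (h1 b) f
  haveI := MulEquiv.isDomain (AdjoinRoot PF)
    (AlgEquiv.ofBijective χ ⟨χ.toRingHom.injective, hsurj⟩).symm.toMulEquiv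
  -- `A ⊗ K → F ⊗ K` is injective (`K` is flat over `k`)
  let θ : A ⊗[k] K →ₐ[k] F ⊗[k] K :=
    Algebra.TensorProduct.map (IsScalarTower.toAlgHom k A F) (AlgHom.id k K)
  have key : θ.toLinearMap = LinearMap.rTensor K (IsScalarTower.toAlgHom k A F).toLinearMap :=
    TensorProduct.ext' fun x y => by simp [θ]
  have hθ : Function.Injective θ.toLinearMap := by
    rw [key]
    exact Module.Flat.rTensor_preserves_injective_linearMap _ hAF
  exact Function.Injective.isDomain θ hθ

end Algebra

/-! ## Sections of a `k`-scheme as `k`-algebras; base change of an affine open -/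

section Sections

variable {k : Type u} [Field k] {X : Scheme.{u}} (f : X ⟶ Spec (.of k))

/-- The structure maps `k → Γ(X, U)`, `c ↦ f♯(c)|_U`, of the `k`-scheme `f : X → Spec k` are
compatible with restriction. [folklore] -/
theorem map_kToΓ {U V : X.Opens} (i : V ≤ U) (x : k) :
    X.presheaf.map (homOfLE i).op (((Scheme.ΓSpecIso (.of k)).inv ≫ f.appLE ⊤ U le_top) x) =
      ((Scheme.ΓSpecIso (.of k)).inv ≫ f.appLE ⊤ V le_top) x := by
  rw [← CommRingCat.comp_apply, Category.assoc, Scheme.Hom.appLE_map]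

/-- Over an affine open `U`, the composite `Spec Γ(X, U) → X → Spec k` is `Spec` of the structure
map `k → Γ(X, U)`. [folklore] -/
theorem fromSpec_comp_eq_SpecMap {U : X.Opens} (hU : IsAffineOpen U) :
    hU.fromSpec ≫ f = Spec.map ((Scheme.ΓSpecIso (.of k)).inv ≫ f.appLE ⊤ U le_top) := by
  have h := IsAffineOpen.SpecMap_appLE_fromSpec f (isAffineOpen_top (Spec (.of k))) hU
    (le_top : U ≤ f ⁻¹ᵁ ⊤)
  rw [IsAffineOpen.fromSpec_top, Scheme.isoSpec_Spec_inv, ← Spec.map_comp] at h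
  exact h.symm

/-- **Base change of an affine open.** For an open immersion `j : Spec A ↪ X` with image `U`, `A` a
`k`-algebra with `j ≫ f = Spec (k → A)`, the open `U ×ₖ Spec K ⊆ X ×ₖ Spec K` is isomorphic to
`Spec (A ⊗ₖ K)`; in particular it is reduced as soon as `A ⊗ₖ K` is. [folklore] -/
theorem isReduced_preimage_of_isReduced_tensorProduct (K : Type u) [Field K] [Algebra k K]
    {A : Type u} [CommRing A] [Algebra k A] (j : Spec (.of A) ⟶ X) [IsOpenImmersion j]
    (hj : j ≫ f = Spec.map (CommRingCat.ofHom (algebraMap k A))) (U : X.Opens)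
    (hU : Set.range j = (U : Set X)) [_root_.IsReduced (A ⊗[k] K)] :
    IsReduced (↑(pullback.fst f (Spec.map (CommRingCat.ofHom (algebraMap k K))) ⁻¹ᵁ U) :
      Scheme.{u}) := by
  set g := Spec.map (CommRingCat.ofHom (algebraMap k K))
  -- `Spec (A ⊗ K) ≅ Spec A ×ₖ Spec K ≅ Spec A ×_X (X ×ₖ Spec K) → X ×ₖ Spec K`
  let e : Spec (.of (A ⊗[k] K)) ≅ pullback j (pullback.fst f g) := (pullbackSpecIso k A K).symm ≪≫
    (pullback.congrHom (g₁ := g) hj rfl).symm ≪≫ (pullbackRightPullbackFstIso f g j).symm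
  have hm : Set.range (e.hom ≫ pullback.snd j (pullback.fst f g)) =
      ((pullback.fst f g ⁻¹ᵁ U : Opens _) : Set _) := by
    rw [Scheme.Hom.comp_base, TopCat.coe_comp, Set.range_comp, e.hom.surjective.range_eq,
      Set.image_univ, Scheme.Pullback.range_snd, hU]
    rfl
  exact isReduced_of_isOpenImmersion (IsOpenImmersion.isoOfRangeEq _ (pullback.fst f g ⁻¹ᵁ U).ι
    (hm.trans (Scheme.Opens.range_ι _).symm)).inv

end Sections

section Section

variable {Z X : Scheme.{u}} (ρ : Z ⟶ X)

/-- **An injective affine morphism from a reduced scheme with a section over an open `U` is an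
isomorphism over `U`**: the section factors through `ρ⁻¹ U` as a surjective closed immersion into a
reduced scheme, i.e. an isomorphism. [folklore] -/
theorem isIso_morphismRestrict_of_section [IsAffineHom ρ] [IsReduced Z]
    (hinj : Function.Injective ρ) (U : X.Opens) (t : ↑U ⟶ Z) (ht : t ≫ ρ = U.ι) :
    IsIso (ρ ∣_ U) := by
  have hrange : Set.range t ⊆ Set.range (ρ ⁻¹ᵁ U).ι := by
    rintro _ ⟨u, rfl⟩
    rw [Scheme.Opens.range_ι]
    show ρ (t u) ∈ U
    rw [← Scheme.Hom.comp_apply, ht, Scheme.Opens.ι_apply]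
    exact u.2
  set t₂ := IsOpenImmersion.lift (ρ ⁻¹ᵁ U).ι t hrange with ht₂def
  have ht₂ : t₂ ≫ (ρ ⁻¹ᵁ U).ι = t := IsOpenImmersion.lift_fac _ _ _
  have hsec : t₂ ≫ (ρ ∣_ U) = 𝟙 _ := by
    rw [← cancel_mono U.ι, Category.assoc, morphismRestrict_ι, ← Category.assoc, ht₂, ht,
      Category.id_comp]
  haveI : IsAffineHom (ρ ∣_ U) := IsZariskiLocalAtTarget.restrict ‹_› U
  haveI : IsClosedImmersion (t₂ ≫ ρ ∣_ U) := by rw [hsec]; infer_instance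
  haveI : IsClosedImmersion t₂ := IsClosedImmersion.of_comp t₂ (ρ ∣_ U)
  have hinj' : Function.Injective (ρ ∣_ U) := fun z₁ z₂ h => by
    apply Subtype.ext
    have h' := congrArg Subtype.val h
    rw [morphismRestrict_base_coe, morphismRestrict_base_coe] at h'
    exact hinj h'
  haveI : Surjective t₂ := ⟨fun z => ⟨(ρ ∣_ U) z, hinj' (by
    rw [← Scheme.Hom.comp_apply, hsec]; rfl)⟩⟩
  haveI : IsIso t₂ := isIso_of_isClosedImmersion_of_surjective t₂
  haveI : IsIso (t₂ ≫ ρ ∣_ U) := by rw [hsec]; infer_instance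
  exact IsIso.of_isIso_comp_left t₂ (ρ ∣_ U)

/-- **Birationality from a section.** An injective affine morphism `ρ : Z → X` of irreducible
schemes, `Z` reduced, with a section over a non-empty open `U ⊆ X` is birational. [folklore] -/
theorem isBirational_of_section [IrreducibleSpace X] [IrreducibleSpace Z] [IsAffineHom ρ]
    [IsReduced Z] (hinj : Function.Injective ρ) (U : X.Opens) [hU : Nonempty U] (t : ↑U ⟶ Z)
    (ht : t ≫ ρ = U.ι) : IsBirational ρ := by
  haveI := isIso_morphismRestrict_of_section ρ hinj U t ht
  obtain ⟨x⟩ := hU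
  refine ⟨U, U.2.dense ⟨x.1, x.2⟩, (ρ ⁻¹ᵁ U).2.dense ⟨t x, ?_⟩, inferInstance⟩
  show ρ (t x) ∈ U
  rw [← Scheme.Hom.comp_apply, ht, Scheme.Opens.ι_apply]
  exact x.2

end Section

/-! ## The one-root step for integral `X`: the two cases -/

section OneRoot

variable {k K : Type u} [Field k] [Field K] [Algebra k K] {p : ℕ} [hp : Fact p.Prime]
  {X : Scheme.{u}} [IsIntegral X] (f : X ⟶ Spec (.of k))

/-- **Case `a ∈ k(X)^p`: a section.** If `β ∈ Γ(X, U)`, `U` affine open, satisfies `β ^ p = a`,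
then `T ↦ β` defines `K = k[T]/(T^p - a) → Γ(X, U)`, i.e. a section `U → U ×ₖ Spec K` of the
projection, which factors through the reduction `Z ↪ X ×ₖ Spec K` (`U` is reduced). [folklore] -/
theorem exists_section_of_pow_eq (a : k) (α : K) (ha : ∀ b : k, b ^ p ≠ a)
    (hα : α ^ p = algebraMap k K a) (htop : IntermediateField.adjoin k {α} = ⊤)
    {U : X.Opens} (hU : IsAffineOpen U) (β : Γ(X, U))
    (hβ : β ^ p = ((Scheme.ΓSpecIso (.of k)).inv ≫ f.appLE ⊤ U le_top) a) {Z : Scheme.{u}}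
    (ι : Z ⟶ pullback f (Spec.map (CommRingCat.ofHom (algebraMap k K)))) [IsClosedImmersion ι]
    [Surjective ι] : ∃ t : ↑U ⟶ Z,
      t ≫ ι ≫ pullback.fst f (Spec.map (CommRingCat.ofHom (algebraMap k K))) = U.ι := by
  letI : Algebra k Γ(X, U) := ((Scheme.ΓSpecIso (.of k)).inv ≫ f.appLE ⊤ U le_top).hom.toAlgebra
  obtain ⟨ψ⟩ := nonempty_algHom_of_pow_eq a α ha hα htop β hβ
  have w : hU.fromSpec ≫ f = Spec.map (CommRingCat.ofHom (ψ : K →+* Γ(X, U))) ≫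
      Spec.map (CommRingCat.ofHom (algebraMap k K)) := by
    rw [fromSpec_comp_eq_SpecMap f hU, ← Spec.map_comp, ← CommRingCat.ofHom_comp,
      AlgHom.comp_algebraMap]
    rfl
  have hker : ι.ker ≤ (pullback.lift hU.fromSpec
      (Spec.map (CommRingCat.ofHom (ψ : K →+* Γ(X, U)))) w).ker := by
    refine le_trans ?_ (nilradical_le_ker _)
    rw [← Scheme.IdealSheafData.vanishingIdeal_top
        (X := pullback f (Spec.map (CommRingCat.ofHom (algebraMap k K)))),
      ← Scheme.IdealSheafData.le_support_iff_le_vanishingIdeal]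
    intro x _
    rw [← SetLike.mem_coe, Scheme.Hom.support_ker, ι.surjective.range_eq, closure_univ]
    trivial
  refine ⟨hU.isoSpec.hom ≫ IsClosedImmersion.lift ι _ hker, ?_⟩
  rw [Category.assoc, IsClosedImmersion.lift_fac_assoc, pullback.lift_fst,
    ← IsAffineOpen.isoSpec_inv_ι, Iso.hom_inv_id_assoc]

/-- **Case `a ∉ k(X)^p`: `X ×ₖ Spec K` is reduced**, being covered by the spectra of the domains
`A ⊗ₖ K ⊆ k(X) ⊗ₖ K` for `U = Spec A ⊆ X` non-empty affine open. [folklore] -/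
theorem isReduced_pullback_of_forall_pow_ne (a : k) (α : K) (hα : α ^ p = algebraMap k K a)
    (htop : IntermediateField.adjoin k {α} = ⊤)
    (hF : ∀ γ : X.functionField, γ ^ p ≠ X.presheaf.germ ⊤ (genericPoint X) trivial
      (((Scheme.ΓSpecIso (.of k)).inv ≫ f.appLE ⊤ ⊤ le_top) a)) :
    IsReduced (pullback f (Spec.map (CommRingCat.ofHom (algebraMap k K)))) := by
  set q := pullback.fst f (Spec.map (CommRingCat.ofHom (algebraMap k K)))
  let S := {U : X.affineOpens // Nonempty (U : X.Opens)}
  have hcov : TopologicalSpace.IsOpenCover fun U : S => q ⁻¹ᵁ (U.1 : X.Opens) := by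
    refine top_le_iff.mp fun z _ => ?_
    obtain ⟨U, hU, hzU, -⟩ :=
      exists_isAffineOpen_mem_and_subset (show q z ∈ (⊤ : X.Opens) from trivial)
    exact Opens.mem_iSup.mpr ⟨⟨⟨U, hU⟩, ⟨⟨_, hzU⟩⟩⟩, hzU⟩
  letI : Algebra k X.functionField := ((X.presheaf.germ ⊤ (genericPoint X) trivial).hom.comp
    ((Scheme.ΓSpecIso (.of k)).inv ≫ f.appLE ⊤ ⊤ le_top).hom).toAlgebra
  have hred : ∀ U : S, IsReduced (↑(q ⁻¹ᵁ (U.1 : X.Opens)) : Scheme.{u}) := fun U => by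
    haveI : Nonempty (U.1 : X.Opens) := U.2
    letI : Algebra k Γ(X, U.1) :=
      ((Scheme.ΓSpecIso (.of k)).inv ≫ f.appLE ⊤ U.1 le_top).hom.toAlgebra
    haveI : IsScalarTower k Γ(X, U.1) X.functionField :=
      IsScalarTower.of_algebraMap_eq fun x => by
        show X.presheaf.germ ⊤ (genericPoint X) trivial
            (((Scheme.ΓSpecIso (.of k)).inv ≫ f.appLE ⊤ ⊤ le_top) x) =
          X.germToFunctionField U.1 (((Scheme.ΓSpecIso (.of k)).inv ≫ f.appLE ⊤ U.1 le_top) x)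
        rw [← map_kToΓ f (le_top : (U.1 : X.Opens) ≤ ⊤)]
        exact (X.presheaf.germ_res_apply (homOfLE le_top) _ _ _).symm
    haveI : IsFractionRing Γ(X, U.1) X.functionField :=
      functionField_isFractionRing_of_isAffineOpen X U.1 U.1.2
    haveI : IsDomain (Γ(X, U.1) ⊗[k] K) := isDomain_tensorProduct_of_forall_pow_ne
      (IsFractionRing.injective Γ(X, U.1) X.functionField) a α hα htop hF
    exact isReduced_preimage_of_isReduced_tensorProduct f K U.1.2.fromSpec
      (fromSpec_comp_eq_SpecMap f U.1.2) U.1 U.1.2.range_fromSpec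
  exact @IsReduced.of_openCover _ (Scheme.openCoverOfIsOpenCover _ _ hcov) hred

/-- **The one-root step for integral `X` from the geometrically integral core.** `ρ : Z ↪ X_K → X`
is a finite homeomorphism, so `Z` is integral. If `a = γ^p` in `k(X)` then `γ` is a section `β`
over a non-empty affine open `U`, `ρ` has a section over `U` and is proper birational, and a
resolution of `Z` resolves `X`; otherwise `X_K` is reduced, the surjective closed immersion `ι` is
an isomorphism, `X_K ≅ Z` is integral with a resolution, and the core applies. [folklore] -/
theorem hasResolution_of_oneRoot_core [CharP k p] (a : k) (α : K) (ha : ∀ b : k, b ^ p ≠ a)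
    (hα : α ^ p = algebraMap k K a) (htop : IntermediateField.adjoin k {α} = ⊤)
    (hcore : IsIntegral (pullback f (Spec.map (CommRingCat.ofHom (algebraMap k K)))) →
      Scheme.HasResolution (pullback f (Spec.map (CommRingCat.ofHom (algebraMap k K)))) →
      Scheme.HasResolution X)
    {Z : Scheme.{u}} (ι : Z ⟶ pullback f (Spec.map (CommRingCat.ofHom (algebraMap k K))))
    [IsClosedImmersion ι] [Surjective ι] [IsReduced Z] (hZ : Scheme.HasResolution Z) :
    Scheme.HasResolution X := by
  haveI : IsPurelyInseparable k K := by
    rw [isPurelyInseparable_iff_perfectClosure_eq_top, eq_top_iff, ← htop,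
      IntermediateField.adjoin_simple_le_iff, mem_perfectClosure_iff_pow_mem p]
    exact ⟨1, a, by rw [pow_one, hα]⟩
  haveI : FiniteDimensional k (⊤ : IntermediateField k K) := by
    rw [← htop]; exact IntermediateField.adjoin.finiteDimensional (isIntegral_of_pow_eq a α hα)
  haveI : FiniteDimensional k K := IntermediateField.topEquiv.toLinearEquiv.finiteDimensional
  haveI : IsFinite (Spec.map (CommRingCat.ofHom (algebraMap k K))) := by
    rw [IsFinite.SpecMap_iff, CommRingCat.hom_ofHom, RingHom.finite_algebraMap]
    infer_instance
  set q := pullback.fst f (Spec.map (CommRingCat.ofHom (algebraMap k K)))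
  haveI : IsFinite q := MorphismProperty.pullback_fst _ _ inferInstance
  haveI := universallyInjective_SpecMap_of_isPurelyInseparable k K
  haveI : UniversallyInjective q := MorphismProperty.pullback_fst _ _ inferInstance
  haveI : Surjective q := MorphismProperty.pullback_fst _ _ inferInstance
  -- `ρ = ι ≫ q` is an injective, closed, surjective continuous map: a homeomorphism
  have hinj : Function.Injective (ι ≫ q) := fun x y hxy => by
    rw [Scheme.Hom.comp_apply, Scheme.Hom.comp_apply] at hxy
    exact ι.isClosedEmbedding.injective (q.injective hxy)
  have hφ : IsHomeomorph (ι ≫ q) := isHomeomorph_iff_continuous_isClosedMap_bijective.mpr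
    ⟨(ι ≫ q).continuous, (ι ≫ q).isClosedMap, hinj, (ι ≫ q).surjective⟩
  haveI : IrreducibleSpace Z := (hφ.homeomorph (ι ≫ q)).irreducibleSpace_iff.mpr inferInstance
  haveI : IsIntegral Z := isIntegral_of_irreducibleSpace_of_isReduced Z
  by_cases hex : ∃ γ : X.functionField, γ ^ p = X.presheaf.germ ⊤ (genericPoint X) trivial
      (((Scheme.ΓSpecIso (.of k)).inv ≫ f.appLE ⊤ ⊤ le_top) a)
  · -- case (i): `a` is a `p`-th power in `k(X)`: a section over a non-empty affine open
    obtain ⟨γ, hγ⟩ := hex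
    obtain ⟨V, hV, s, hs⟩ := X.presheaf.exists_germ_eq γ
    obtain ⟨_, ⟨U, hU, rfl⟩, hηU, hUV⟩ :=
      X.isBasis_affineOpens.exists_subset_of_mem_open hV V.isOpen
    haveI : Nonempty U := ⟨⟨_, hηU⟩⟩
    let β : Γ(X, U) := X.presheaf.map (homOfLE hUV).op s
    have h1 : X.presheaf.germ U (genericPoint X) hηU β = γ := by
      simp only [← hs, ← X.presheaf.germ_res_apply (homOfLE hUV) (genericPoint X) hηU s, β]
      rfl
    have hβ : β ^ p = ((Scheme.ΓSpecIso (.of k)).inv ≫ f.appLE ⊤ U le_top) a := by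
      apply germ_injective_of_isIntegral X (genericPoint X) hηU
      rw [map_pow, h1, hγ, ← map_kToΓ f (le_top : U ≤ ⊤)]
      exact (X.presheaf.germ_res_apply (homOfLE le_top) _ _ _).symm
    obtain ⟨t, ht⟩ := exists_section_of_pow_eq f a α ha hα htop hU β hβ ι
    exact Scheme.HasResolution.of_isBirational _ (isBirational_of_section _ hinj U t ht) hZ
  · -- case (ii): `X_K` is reduced, hence `ι` is an isomorphism and `X_K` is integral
    push Not at hex
    haveI := isReduced_pullback_of_forall_pow_ne f a α hα htop hex
    haveI : IsIso ι := isIso_of_isClosedImmersion_of_surjective ι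
    exact hcore (IsIntegral.of_isIso ι) (hZ.of_iso ι)

end OneRoot

/-- STUB `stub_oneRootReduceToGeomIntegral` (R2): the sharpened core (one-root descent for
integral `X` with `X ×ₖ K` integral) implies the one-root step for all integral `X`, by the case
split on whether `a` is a `p`-th power in the function field `k(X)` (`Z → X` finite birational,
resp. `X ×ₖ K` reduced hence `= Z` and integral): `hasResolution_of_oneRoot_core`. [folklore] -/
theorem stub_oneRootReduceToGeomIntegral : ∀ (p : ℕ) [Fact p.Prime], (∀ (k K : Type) [Field k] [Field K] [Algebra k K] [CharP k p] (a : k) (α : K), (∀ b : k, b ^ p ≠ a) → α ^ p = algebraMap k K a → IntermediateField.adjoin k {α} = ⊤ → ∀ (X : Scheme.{0}) (f : X ⟶ Spec (.of k)), IsSeparated f → LocallyOfFiniteType f → QuasiCompact f → IsIntegral X → IsIntegral (pullback f (Spec.map (CommRingCat.ofHom (algebraMap k K)))) → Scheme.HasResolution (pullback f (Spec.map (CommRingCat.ofHom (algebraMap k K)))) → Scheme.HasResolution X) → (∀ (k K : Type) [Field k] [Field K] [Algebra k K] [CharP k p] (a : k) (α : K), (∀ b : k, b ^ p ≠ a) →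 α ^ p = algebraMap k K a → IntermediateField.adjoin k {α} = ⊤ → ∀ (X : Scheme.{0}) (f : X ⟶ Spec (.of k)), IsSeparated f → LocallyOfFiniteType f → QuasiCompact f → IsIntegral X → ∀ (Z : Scheme.{0}) (ι : Z ⟶ pullback f (Spec.map (CommRingCat.ofHom (algebraMap k K)))), IsClosedImmersion ι → Surjective ι → IsReduced Z → Scheme.HasResolution Z → Scheme.HasResolution X) := by
  intro p _ hcore k K _ _ _ _ a α ha hα htop X f hsep hlft hqc hint Z ι hι hsurj hZred hZ
  haveI := hint; haveI := hι; haveI := hsurj; haveI := hZred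
  exact hasResolution_of_oneRoot_core f a α ha hα htop
    (fun h₁ h₂ => hcore k K a α ha hα htop X f hsep hlft hqc hint h₁ h₂) ι hZ

end Summit.ResolutionOfSingularities.ResolutionOfSingularities.Theorems

end
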